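import Summits.PneNP.PneNP.Theorems.RamseyUncertifiableResolutionUncertaintyRestrictRefutation

/-!
# `RegularResolutionRung` (stmt-PneNP-9818), line `sound-path-bottleneck`:
# REGULAR refutations of the unary clique CNF restrict to induced subgraphs

Stub `stub_restrictToInduced` of the line's skeleton. For an induced subgraph `e : Fin m ↪ Fin n` of
a graph `adj` on `Fin n`, every REGULAR resolution refutation `π` of `Clique(adj, k)`
(`cliqueCNF n k adj`) yields a regular resolution refutation of `Clique(adj ∘ (e × e), k)` with at
most `π.length` lines (Ben-Sasson–Wigderson 2001 §2.2, restriction of a refutation by a partial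
assignment, plus a renaming; ABdRLNR arXiv:2012.09476 Fact 2.1 / 3.2; folklore).

* `exists_map_restrict_regular` (generic in the CNFs): the tree's
  `IsResRefutation.exists_map_restrict` (`Literature/Computability/MetaComplexity/ResolutionRestrictionMap.lean`)
  keeps its line map internal, so its proof is re-done here with the same map (validity part
  copied) and REGULARITY is transported along it: the premise list of a translated line is
  contained in the original one, so DAG paths of the new refutation are DAG paths of `π`, and the
  pivots met along a path are the injectively renamed unassigned pivots of `π` along the same path
  (`nodup_filterMap_of_refines`).
* The clique-specific restriction pair (zero every `x_{i,v}` with `v ∉ range e`, rename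
  `x_{i,e a} ↦ x_{i,a}`) and its clause check are the sibling crux's
  `RestrictRefutation.exists_restriction` / `RestrictRefutation.clause_transfer`
  (`RamseyUncertifiableResolutionUncertaintyRestrictRefutation.lean`, stmt-PneNP-9816), reused.
-/

set_option linter.dupNamespace false -- Summit.PneNP.PneNP: single-conjunct summit

namespace Summit.PneNP.PneNP.Cruxes.RegularResolutionRung.SoundPathBottleneck

open Literature.Computability.MetaComplexity Literature.Computability.Complexity
open Summit.PneNP.PneNP.Theorems.RegularResolutionRung.Negative (cliqueCNF digits_of block_mem edge_mem)
open Summit.PneNP.PneNP.Theorems.RamseyUncertifiableResolutionUncertainty.RestrictRefutation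
  (exists_restriction clause_transfer ne_nil_of_isResRefutation)

/-! ## Generic part: restriction-and-renaming preserves regularity -/

/-- Transport of `Nodup` along a refinement of `filterMap`s: if every value of `g` is the image
under `f'` of a value of `f` satisfying `P`, and `f'` is injective on `P`, then `p.filterMap g` has
no duplicates when `p.filterMap f` has none. -/
theorem nodup_filterMap_of_refines {α β γ : Type*} {f : α → Option β} {g : α → Option γ}
    {P : β → Prop} {f' : β → γ} (hinj : ∀ x y, P x → P y → f' x = f' y → x = y)
    (hfg : ∀ a w, g a = some w → ∃ v, f a = some v ∧ P v ∧ f' v = w) (p : List α)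
    (hp : (p.filterMap f).Nodup) : (p.filterMap g).Nodup := by
  induction p with
  | nil => simp
  | cons a p ih =>
    have hp' : (p.filterMap f).Nodup := by
      rcases hf : f a with _ | v
      · rwa [List.filterMap_cons_none hf] at hp
      · rw [List.filterMap_cons_some hf] at hp
        exact (List.nodup_cons.1 hp).2
    rcases hg : g a with _ | w
    · rw [List.filterMap_cons_none hg]
      exact ih hp'
    · rw [List.filterMap_cons_some hg]
      obtain ⟨v, hfa, hPv, hev⟩ := hfg a w hg
      rw [List.filterMap_cons_some hfa] at hp
      obtain ⟨hv, -⟩ := List.nodup_cons.1 hp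
      refine List.nodup_cons.2 ⟨fun hw => ?_, ih hp'⟩
      obtain ⟨a', ha', hga'⟩ := List.mem_filterMap.1 hw
      obtain ⟨v', hfa', hPv', hev'⟩ := hfg a' w hga'
      have hvv : v' = v := hinj v' v hPv' hPv (hev'.trans hev.symm)
      subst hvv
      exact hv (List.mem_filterMap.2 ⟨a', ha', hfa'⟩)

variable {ν μ : Type*} [DecidableEq ν] [DecidableEq μ]

/-- **Restriction-and-renaming transfer of REGULAR refutations, length form.** Let
`ρ : ν → Option Bool` be a partial assignment and `e : ν → μ` a renaming injective on the variables
unassigned by `ρ`; let `ψ : CNF μ` be non-empty and such that every set-clause of `φ` is either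
satisfied by `ρ` or has its restriction-and-renaming `e(C|ρ)` among the set-clauses of `ψ`. Then
every REGULAR resolution refutation of `φ` yields a regular resolution refutation of `ψ` of the same
length. The line map is the one of `IsResRefutation.exists_map_restrict` (a satisfied line becomes a
junk axiom, any other line `C` becomes `e(C|ρ)`, a resolution step on an assigned pivot becomes a
weakening, line indices are kept); regularity is inherited because premise lists only shrink and
pivots are renamed injectively. -/
theorem exists_map_restrict_regular {φ : CNF ν} {ψ : CNF μ} (ρ : ν → Option Bool) (e : ν → μ)
    (hinj : ∀ x y, ρ x = none → ρ y = none → e x = e y → x = y) (hψ : ψ ≠ [])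
    (hcl : ∀ C ∈ φ.clauseFinsets, SatisfiedBy ρ C ∨
      (restrictClause ρ C).image (fun l => ((e l.1, l.2) : Literal μ)) ∈ ψ.clauseFinsets)
    {π : List (ResLine ν)} (hπ : IsResRefutation φ π) (hreg : IsRegular π) :
    ∃ π' : List (ResLine μ), IsResRefutation ψ π' ∧ IsRegular π' ∧ π'.length = π.length := by
  -- The line map and its validity are adapted (copied) from the proof of
  -- `IsResRefutation.exists_map_restrict` in
  -- Literature/Computability/MetaComplexity/ResolutionRestrictionMap.lean; regularity is new.
  classical
  -- a junk axiom for the satisfied lines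
  obtain ⟨C₀, hC₀⟩ : ∃ C₀ : Finset (Literal μ), C₀ ∈ ψ.clauseFinsets := by
    obtain ⟨c, hc⟩ := List.exists_mem_of_ne_nil ψ hψ
    exact ⟨c.toFinset, List.mem_map.2 ⟨c, hc, rfl⟩⟩
  -- the literal renaming, the rule translation and the line translation
  let ê : Literal ν → Literal μ := fun l => (e l.1, l.2)
  let TR : ResRule ν → ResRule μ := fun r =>
    match r with
    | .initial => .initial
    | .weaken i => .weaken i
    | .resolve i j v =>
      match ρ v with
      | none => .resolve i j (e v)
      | some true => .weaken j
      | some false => .weaken i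
  let T : ResLine ν → ResLine μ := fun l =>
    if SatisfiedBy ρ l.clause then ⟨C₀, .initial⟩ else ⟨(restrictClause ρ l.clause).image ê, TR l.rule⟩
  have hT_sat : ∀ l : ResLine ν, SatisfiedBy ρ l.clause → T l = ⟨C₀, .initial⟩ :=
    fun l h => if_pos h
  have hT_ns : ∀ l : ResLine ν, ¬ SatisfiedBy ρ l.clause →
      T l = ⟨(restrictClause ρ l.clause).image ê, TR l.rule⟩ := fun l h => if_neg h
  -- validity of one translated line
  have key : ∀ (prev : List (ResLine ν)) (l : ResLine ν), IsValidResLine φ prev l →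
      IsValidResLine ψ (prev.map T) (T l) := by
    intro prev l hv
    by_cases hsat : SatisfiedBy ρ l.clause
    · rw [hT_sat l hsat]
      exact hC₀
    rw [hT_ns l hsat]
    obtain ⟨C, r⟩ := l
    simp only at hsat ⊢
    cases r with
    | initial =>
      unfold IsValidResLine at hv ⊢
      rcases hcl C hv with h | h
      · exact absurd h hsat
      · exact h
    | weaken i =>
      unfold IsValidResLine at hv ⊢
      obtain ⟨hi, hsub⟩ := hv
      have hns : ¬ SatisfiedBy ρ (prev[i]).clause := fun h => hsat (h.mono hsub)
      refine ⟨by simpa using hi, ?_⟩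
      simp only [List.getElem_map]
      rw [hT_ns _ hns]
      exact Finset.image_subset_image (restrictClause_mono hsub)
    | resolve i j v =>
      unfold IsValidResLine at hv
      obtain ⟨hi, hj, hvC, hvD, hE⟩ := hv
      simp only at hE
      have hi' : i < (prev.map T).length := by simpa using hi
      have hj' : j < (prev.map T).length := by simpa using hj
      rcases hρv : ρ v with _ | _ | _
      · -- unassigned pivot: a resolution step on `e v`
        have hns₁ : ¬ SatisfiedBy ρ (prev[i]).clause :=
          not_satisfiedBy_premise (b := true) (by rw [hE]; exact Finset.subset_union_left) hsat
            (by rw [hρv]; simp)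
        have hns₂ : ¬ SatisfiedBy ρ (prev[j]).clause :=
          not_satisfiedBy_premise (b := false) (by rw [hE]; exact Finset.subset_union_right) hsat
            (by rw [hρv]; simp)
        have hTR : TR (.resolve i j v) = .resolve i j (e v) := by simp only [TR, hρv]
        rw [hTR]
        unfold IsValidResLine
        refine ⟨hi', hj', ?_, ?_, ?_⟩
        · simp only [List.getElem_map]
          rw [hT_ns _ hns₁]
          exact Finset.mem_image.2 ⟨(v, true), mem_restrictClause.2 ⟨hvC, hρv⟩, rfl⟩
        · simp only [List.getElem_map]
          rw [hT_ns _ hns₂]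
          exact Finset.mem_image.2 ⟨(v, false), mem_restrictClause.2 ⟨hvD, hρv⟩, rfl⟩
        · simp only [List.getElem_map]
          rw [hT_ns _ hns₁, hT_ns _ hns₂]
          simp only
          rw [hE, image_restrictClause_union, image_restrictClause_erase hinj _ hρv,
            image_restrictClause_erase hinj _ hρv]
      · -- `ρ v = false`: the premise `prev[i] ∋ (v, true)` is not satisfied; weaken it
        have hns₁ : ¬ SatisfiedBy ρ (prev[i]).clause :=
          not_satisfiedBy_premise (b := true) (by rw [hE]; exact Finset.subset_union_left) hsat
            (by rw [hρv]; simp)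
        have hTR : TR (.resolve i j v) = .weaken i := by simp only [TR, hρv]
        rw [hTR]
        unfold IsValidResLine
        refine ⟨hi', ?_⟩
        simp only [List.getElem_map]
        rw [hT_ns _ hns₁]
        refine Finset.image_subset_image (fun l hl => ?_)
        rw [mem_restrictClause] at hl ⊢
        refine ⟨?_, hl.2⟩
        rw [hE]
        refine Finset.mem_union_left _ (Finset.mem_erase.2 ⟨?_, hl.1⟩)
        rintro rfl
        exact absurd hl.2 (by rw [hρv]; simp)
      · -- `ρ v = true`: the premise `prev[j] ∋ (v, false)` is not satisfied; weaken it
        have hns₂ : ¬ SatisfiedBy ρ (prev[j]).clause :=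
          not_satisfiedBy_premise (b := false) (by rw [hE]; exact Finset.subset_union_right) hsat
            (by rw [hρv]; simp)
        have hTR : TR (.resolve i j v) = .weaken j := by simp only [TR, hρv]
        rw [hTR]
        unfold IsValidResLine
        refine ⟨hj', ?_⟩
        simp only [List.getElem_map]
        rw [hT_ns _ hns₂]
        refine Finset.image_subset_image (fun l hl => ?_)
        rw [mem_restrictClause] at hl ⊢
        refine ⟨?_, hl.2⟩
        rw [hE]
        refine Finset.mem_union_right _ (Finset.mem_erase.2 ⟨?_, hl.1⟩)
        rintro rfl
        exact absurd hl.2 (by rw [hρv]; simp)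
  -- REGULARITY. The translated rule has no new premises ...
  have hTR_prem : ∀ (r : ResRule ν) (b : ℕ), b ∈ (TR r).premises → b ∈ r.premises := by
    intro r b hb
    cases r with
    | initial => simp [TR, ResRule.premises] at hb
    | weaken i => simpa [TR, ResRule.premises] using hb
    | resolve i j v =>
      rcases hρv : ρ v with _ | _ | _ <;> simp [TR, hρv, ResRule.premises] at hb ⊢ <;> omega
  have hT_prem : ∀ (l : ResLine ν) (b : ℕ), b ∈ (T l).premises → b ∈ l.premises := by
    intro l b hb
    by_cases hs : SatisfiedBy ρ l.clause
    · rw [hT_sat l hs] at hb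
      simp [ResLine.premises, ResRule.premises] at hb
    · rw [hT_ns l hs] at hb
      exact hTR_prem l.rule b hb
  -- ... and its pivot, if any, is the renaming of an unassigned pivot of the original rule
  have hT_piv : ∀ (l : ResLine ν) (w : μ), (T l).rule.pivot? = some w →
      ∃ v, l.rule.pivot? = some v ∧ ρ v = none ∧ e v = w := by
    intro l w h
    by_cases hs : SatisfiedBy ρ l.clause
    · rw [hT_sat l hs] at h
      simp [ResRule.pivot?] at h
    rw [hT_ns l hs] at h
    obtain ⟨C, r⟩ := l
    cases r with
    | initial => simp [TR, ResRule.pivot?] at h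
    | weaken i => simp [TR, ResRule.pivot?] at h
    | resolve i j v =>
      refine ⟨v, rfl, ?_⟩
      rcases hρv : ρ v with _ | _ | _
      · simp only [TR, hρv, ResRule.pivot?, Option.some.injEq] at h
        exact ⟨rfl, h⟩
      · simp [TR, hρv, ResRule.pivot?] at h
      · simp [TR, hρv, ResRule.pivot?] at h
  -- hence DAG paths of `π.map T` are DAG paths of `π` ...
  have hdag : ∀ p, IsDagPath ((π.map T).map ResLine.premises) p →
      IsDagPath (π.map ResLine.premises) p := by
    rintro p ⟨hlen, hchain⟩
    refine ⟨fun i hi => by simpa using hlen i hi, List.IsChain.imp (fun a b hab => ?_) hchain⟩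
    rcases Nat.lt_or_ge a π.length with ha | ha
    · have h1 : ((π.map T).map ResLine.premises).getD a [] = (T (π[a])).premises := by
        simp [List.getD_eq_getElem?_getD, ha]
      have h2 : (π.map ResLine.premises).getD a [] = (π[a]).premises := by
        simp [List.getD_eq_getElem?_getD, ha]
      rw [h1] at hab
      rw [h2]
      exact hT_prem _ b hab
    · have h1 : ((π.map T).map ResLine.premises).getD a [] = [] := by
        simp [List.getD_eq_getElem?_getD, ha]
      rw [h1] at hab
      simp at hab
  -- ... and the pivots along them are injectively renamed sub-lists of the original pivots
  have hregT : IsRegular (π.map T) := by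
    intro p hp
    have hnd := hreg p (hdag p hp)
    unfold pivotsAlong at hnd ⊢
    refine nodup_filterMap_of_refines (P := fun v => ρ v = none) (f' := e) hinj
      (fun a w h => ?_) p hnd
    rw [List.getElem?_map] at h
    rcases hπa : π[a]? with _ | l
    · rw [hπa] at h
      simp at h
    · rw [hπa, Option.map_some, Option.bind_some] at h
      obtain ⟨v, hv, hρ, hev⟩ := hT_piv l w h
      exact ⟨v, by rw [Option.bind_some, hv], hρ, hev⟩
  refine ⟨π.map T, ⟨?_, ?_⟩, hregT, List.length_map _⟩
  · intro k hk
    have hk' : k < π.length := by simpa using hk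
    have h := key (π.take k) (π[k]) (hπ.1 k hk')
    simp only [List.getElem_map]
    rw [List.map_take] at h
    exact h
  · obtain ⟨l, hl, hle⟩ := hπ.2
    refine ⟨T l, List.mem_map.2 ⟨l, hl, rfl⟩, ?_⟩
    have hns : ¬ SatisfiedBy ρ l.clause := by rw [hle]; exact not_satisfiedBy_empty
    rw [hT_ns l hns]
    simp [hle]

/-! ## The stub -/

/-- **stub_restrictToInduced** (folklore; Ben-Sasson–Wigderson 2001 §2.2 + renaming): a regular
resolution refutation of `Clique(adj, k)` restricts, along an induced subgraph `e : Fin m ↪ Fin n`, to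
a regular resolution refutation of `Clique(adj ∘ (e × e), k)` that is no longer. `k = 0` is vacuous
(no clauses, hence no refutation). -/
theorem stub_restrictToInduced :
    ∀ (n m k : ℕ) (adj : Fin n → Fin n → Bool) (e : Fin m ↪ Fin n) (π : List (ResLine ℕ)),
      IsResRefutation (cliqueCNF n k adj) π → IsRegular π →
      ∃ π' : List (ResLine ℕ), IsResRefutation (cliqueCNF m k fun u v => adj (e u) (e v)) π' ∧
        IsRegular π' ∧ π'.length ≤ π.length := by
  intro n m k adj e π hπ hreg
  have hk : 0 < k := Nat.pos_of_ne_zero (by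
    rintro rfl
    exact ne_nil_of_isResRefutation hπ (by simp [cliqueCNF]))
  have hψ : (cliqueCNF m k fun u v => adj (e u) (e v)) ≠ [] :=
    List.ne_nil_of_mem (block_mem k 0 hk _)
  obtain ⟨ρ, r, hlive, hdead, hren, hinj⟩ := exists_restriction n m k e
  obtain ⟨π', hπ', hreg', hlen⟩ :=
    exists_map_restrict_regular ρ r hinj hψ (clause_transfer adj hlive hdead hren) hπ hreg
  exact ⟨π', hπ', hreg', hlen.le⟩

end Summit.PneNP.PneNP.Cruxes.RegularResolutionRung.SoundPathBottleneck
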